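import Summits.CriticalPhenomena.PercolationContinuityZ3.Theorems.PercNearOneGluingNoHeavyLowerTailAntitheticPendant
import HarnessLib

/-!
# `NoHeavyLowerTail` (stmt-CriticalPhenomena-4575) — antithetic cluster pairs: CONTRACTING A DEGREE-2 VERTEX of an arbitrary graph (DEG-2
# ELIMINATION, part 1: clusters; prim-hp-2 gen 40, HOME/MEMO-gen40-theoremC-lean.md §3)

Support file (`--supports stmt-CriticalPhenomena-4575`, hull-port prover `prim-hp-2`, gen 40).  No named facts, no sorries; standard axioms.  The `def`s
`Antithetic.Contract.{swap, expand}` are proof-internal bookkeeping (graph-general versions of `Antithetic.Cyc.{swap, expand}` of file …CycleContract).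

SETTING.  `E` an edge set, `x ≠ s` a vertex meeting exactly the two pairs `e = xy`, `f = xz` of `E` (`y ≠ z`, both `≠ x`), with `g = yz ∉ E`.  The CONTRACTED
edge set is `E' = (E ∖ {e, f}) ∪ {g}` (suppress `x`, merge its two pairs).  `expand` maps an edge set of `E'` to one of `E` (`g ↦ e, f`; increasing);
`swap` exchanges the coordinates `g` and `e` of a colouring.  For a colouring `ω'` whose coordinates `g` and `f` agree ("tied"), `swap ω'` gives `e` and
`f` the common colour of `g`, and then:
* `Contract.reach_swap` — a vertex `u ≠ x` is joined to `s` in `swap ω' ∩ E` iff it is in `ω' ∩ E'`; `Contract.reach_swap_x` — `x` is joined iff `g` is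
  red and one of `y, z` is joined (closed-set arguments on walks: a passage `y – x – z` is the pair `g` and vice versa);
* `Contract.not_reach_contracted` — `x` is never joined to `s` in `ω' ∩ E'`;
* `Contract.cluster_swap` — `C_s(swap ω' ∩ E) = expand (C_s(ω' ∩ E'))`.
The constraint / functional correspondence and the identity `2·Σ_{tied} Δ_E = T_{E'}(R,X; F∘expand, G∘expand)` follow in …AntitheticContractSum.  On a
cycle this is THEOREM C's contraction step (…CycleContract/…CycleContractSum); in general it is the tied half of DEG-2 ELIMINATION.
[cite: VandenbergHaggstromKahn2005, §1 p. 3 (open cluster `C_s`)]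
-/

noncomputable section

namespace Summit.CriticalPhenomena.PercolationContinuityZ3.Theorems

open Literature.Probability.Percolation
open scoped Classical symmDiff

namespace Antithetic

namespace Contract

variable {V : Type*}

/-- Exchange the coordinates `g` and `e` of a colouring. [this work] -/
def swap (e g : Sym2 V) (ω : Set (Sym2 V)) : Set (Sym2 V) :=
  {h | (h = g ∧ e ∈ ω) ∨ (h = e ∧ g ∈ ω) ∨ (h ≠ g ∧ h ≠ e ∧ h ∈ ω)}

/-- Expand an edge set of the contracted graph: the merged pair `g` stands for the two pairs `e`, `f`. [this work] -/
def expand (e f g : Sym2 V) (C : Set (Sym2 V)) : Set (Sym2 V) :=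
  {h | (h ∈ C ∧ h ≠ g) ∨ (g ∈ C ∧ (h = e ∨ h = f))}

section Swap

variable {e g : Sym2 V} (hge : g ≠ e)
include hge

/-- The coordinate `g` of a swapped colouring. -/
theorem mem_swap_g (ω : Set (Sym2 V)) : g ∈ swap e g ω ↔ e ∈ ω := by
  unfold swap; simp only [Set.mem_setOf_eq]
  constructor
  · rintro (⟨-, h⟩ | ⟨h, -⟩ | ⟨h, -, -⟩)
    · exact h
    · exact absurd h hge
    · exact absurd rfl h
  · exact fun h => Or.inl ⟨trivial, h⟩

/-- The coordinate `e` of a swapped colouring. -/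
theorem mem_swap_e (ω : Set (Sym2 V)) : e ∈ swap e g ω ↔ g ∈ ω := by
  unfold swap; simp only [Set.mem_setOf_eq]
  constructor
  · rintro (⟨h, -⟩ | ⟨-, h⟩ | ⟨-, h, -⟩)
    · exact absurd h.symm hge
    · exact h
    · exact absurd rfl h
  · exact fun h => Or.inr (Or.inl ⟨trivial, h⟩)

omit hge in
/-- The other coordinates of a swapped colouring. -/
theorem mem_swap_other (ω : Set (Sym2 V)) {h : Sym2 V} (h1 : h ≠ g) (h2 : h ≠ e) : h ∈ swap e g ω ↔ h ∈ ω := by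
  unfold swap; simp only [Set.mem_setOf_eq]; tauto

/-- `swap` is an involution. -/
theorem swap_swap (ω : Set (Sym2 V)) : swap e g (swap e g ω) = ω := by
  ext h
  by_cases h1 : h = g
  · subst h1; rw [mem_swap_g hge, mem_swap_e hge]
  · by_cases h2 : h = e
    · subst h2; rw [mem_swap_e hge, mem_swap_g hge]
    · rw [mem_swap_other _ h1 h2, mem_swap_other _ h1 h2]

/-- `swap` commutes with complement. -/
theorem swap_compl (ω : Set (Sym2 V)) : (swap e g ω)ᶜ = swap e g ωᶜ := by
  ext h
  rw [Set.mem_compl_iff]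
  by_cases h1 : h = g
  · subst h1; rw [mem_swap_g hge, mem_swap_g hge, Set.mem_compl_iff]
  · by_cases h2 : h = e
    · subst h2; rw [mem_swap_e hge, mem_swap_e hge, Set.mem_compl_iff]
    · rw [mem_swap_other _ h1 h2, mem_swap_other _ h1 h2, Set.mem_compl_iff]

end Swap

/-- `expand` is increasing. -/
theorem expand_mono (e f g : Sym2 V) : Monotone (expand e f g) := by
  intro C D hCD h hh
  rcases hh with ⟨h1, h2⟩ | ⟨h1, h2⟩
  · exact Or.inl ⟨hCD h1, h2⟩
  · exact Or.inr ⟨hCD h1, h2⟩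

/-- Closed sets contain everything reachable from a point where they hold. [folklore] -/
theorem reach_closed {G : SimpleGraph V} {P : V → Prop} (hcl : ∀ u w, P u → G.Adj u w → P w) :
    ∀ {a u : V}, G.Walk a u → P a → P u
  | _, _, .nil, ha => ha
  | _, _, .cons hadj p, ha => reach_closed hcl p (hcl _ _ ha hadj)

section Graph

variable {E : Set (Sym2 V)} {s x y z : V} (hxs : x ≠ s) (hxy : x ≠ y) (hxz : x ≠ z) (hyz : y ≠ z)
  (he : s(x, y) ∈ E) (hf : s(x, z) ∈ E) (hdeg : ∀ h ∈ E, x ∈ h → h = s(x, y) ∨ h = s(x, z)) (hg : s(y, z) ∉ E)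

include hxy hxz in
/-- `x` is not on the merged pair. -/
theorem x_notMem_g : x ∉ s(y, z) := fun hx => by
  rcases Sym2.mem_iff.1 hx with h | h
  · exact hxy h
  · exact hxz h

include hxy hxz in
/-- The merged pair differs from `e = xy`. -/
theorem g_ne_e : s(y, z) ≠ s(x, y) := fun h => x_notMem_g hxy hxz (by rw [h]; exact Sym2.mem_mk_left _ _)

include hxy hxz in
/-- The merged pair differs from `f = xz`. -/
theorem g_ne_f : s(y, z) ≠ s(x, z) := fun h => x_notMem_g hxy hxz (by rw [h]; exact Sym2.mem_mk_left _ _)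

include hyz in
/-- `e ≠ f`. -/
theorem e_ne_f : s(x, y) ≠ s(x, z) := fun h => hyz (Sym2.congr_right.1 h)

include hdeg in
/-- A pair of `E` at `x` leads to `y` or to `z`. -/
theorem nbr_eq {u : V} (hu : s(x, u) ∈ E) : u = y ∨ u = z := by
  rcases hdeg _ hu (Sym2.mem_mk_left _ _) with h | h
  · exact Or.inl (Sym2.congr_right.1 h)
  · exact Or.inr (Sym2.congr_right.1 h)

include hdeg in
/-- A pair of `E` other than `e`, `f` misses `x`. -/
theorem x_notMem {h : Sym2 V} (hh : h ∈ E) (h1 : h ≠ s(x, y)) (h2 : h ≠ s(x, z)) : x ∉ h := fun hx =>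
  (hdeg h hh hx).elim h1 h2

/-- Membership in the contracted edge set `E' = insert g (E ∖ {e, f})`. -/
theorem mem_contracted {h : Sym2 V} :
    h ∈ insert s(y, z) (E \ {s(x, y), s(x, z)}) ↔ h = s(y, z) ∨ (h ∈ E ∧ h ≠ s(x, y) ∧ h ≠ s(x, z)) := by
  simp only [Set.mem_insert_iff, Set.mem_sdiff, Set.mem_singleton_iff, not_or]

include hxs hxy hxz hdeg in
/-- **`x` is never joined to `s` on the contracted edge set** (no pair of `E'` contains `x`). [this work] -/
theorem not_reach_contracted (η : Set (Sym2 V)) :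
    ¬ (openGraph (η ∩ insert s(y, z) (E \ {s(x, y), s(x, z)}))).Reachable s x := by
  refine Pendant.not_reachable_leaf _ _ (fun h hh hx => ?_) hxs.symm
  rcases mem_contracted.1 hh.2 with rfl | ⟨hE, h1, h2⟩
  · exact absurd hx (x_notMem_g hxy hxz)
  · exact absurd hx (x_notMem hdeg hE h1 h2)

include hxs hxy hxz hyz he hf hdeg hg

/-- **Reachability corresponds, forward**: a vertex joined to `s` in `swap ω' ∩ E` is, if `≠ x`, joined to `s` in `ω' ∩ E'`, and if `= x` then `g`
is red and `y` or `z` is joined to `s` in `ω' ∩ E'`. -/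
theorem reach_forward (ω' : Set (Sym2 V)) (hT : s(y, z) ∈ ω' ↔ s(x, z) ∈ ω') (u : V)
    (hu : (openGraph (swap s(x, y) s(y, z) ω' ∩ E)).Reachable s u) :
    (u ≠ x ∧ (openGraph (ω' ∩ insert s(y, z) (E \ {s(x, y), s(x, z)}))).Reachable s u) ∨
      (u = x ∧ s(y, z) ∈ ω' ∧ ((openGraph (ω' ∩ insert s(y, z) (E \ {s(x, y), s(x, z)}))).Reachable s y ∨
        (openGraph (ω' ∩ insert s(y, z) (E \ {s(x, y), s(x, z)}))).Reachable s z)) := by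
  have hge := g_ne_e (y := y) (z := z) hxy hxz
  have hgf := g_ne_f (y := y) (z := z) hxy hxz
  have hef := e_ne_f (x := x) hyz
  set B := openGraph (ω' ∩ insert s(y, z) (E \ {s(x, y), s(x, z)})) with hB
  -- the target predicate is closed under adjacency in the swapped graph
  suffices hcl : ∀ u w, ((u ≠ x ∧ B.Reachable s u) ∨ (u = x ∧ s(y, z) ∈ ω' ∧ (B.Reachable s y ∨ B.Reachable s z))) →
      (openGraph (swap s(x, y) s(y, z) ω' ∩ E)).Adj u w →
      ((w ≠ x ∧ B.Reachable s w) ∨ (w = x ∧ s(y, z) ∈ ω' ∧ (B.Reachable s y ∨ B.Reachable s z))) by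
    obtain ⟨p⟩ := hu
    exact reach_closed hcl p (Or.inl ⟨hxs.symm, SimpleGraph.Reachable.refl _⟩)
  rintro u w hPu hadj
  rw [openGraph_adj] at hadj
  obtain ⟨⟨hsw, hE⟩, hne⟩ := hadj
  -- is g red?
  have hg_red_of : s(u, w) = s(x, y) ∨ s(u, w) = s(x, z) → s(y, z) ∈ ω' := by
    rintro (h | h)
    · rw [h, mem_swap_e hge] at hsw; exact hsw
    · rw [h, mem_swap_other ω' hgf.symm (Ne.symm hef)] at hsw; exact hT.2 hsw
  have hyz_adj : s(y, z) ∈ ω' → B.Adj y z := fun h =>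
    (openGraph_adj _ y z).2 ⟨⟨h, Set.mem_insert _ _⟩, hyz⟩
  by_cases hwx : w = x
  · subst hwx
    right
    have hux : s(w, u) ∈ E := by rw [Sym2.eq_swap]; exact hE
    have huyz := nbr_eq hdeg hux
    have hgred : s(y, z) ∈ ω' := by
      apply hg_red_of
      rcases huyz with rfl | rfl
      · exact Or.inl (Sym2.eq_swap)
      · exact Or.inr (Sym2.eq_swap)
    refine ⟨rfl, hgred, ?_⟩
    rcases hPu with ⟨-, hru⟩ | ⟨hux', -⟩
    · rcases huyz with rfl | rfl
      · exact Or.inl hru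
      · exact Or.inr hru
    · exact absurd hux' hne
  · left
    refine ⟨hwx, ?_⟩
    rcases hPu with ⟨hux', hru⟩ | ⟨rfl, hgred, hr⟩
    · -- u, w ≠ x: the same pair is a pair of E'
      have h1 : s(u, w) ≠ s(x, y) := fun h => x_notMem hdeg hE (fun h' => by
          have : x ∈ s(u, w) := by rw [h']; exact Sym2.mem_mk_left _ _
          rcases Sym2.mem_iff.1 this with h'' | h''
          · exact hux' h''.symm
          · exact hwx h''.symm) (fun h' => by
          have : x ∈ s(u, w) := by rw [h']; exact Sym2.mem_mk_left _ _
          rcases Sym2.mem_iff.1 this with h'' | h''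
          · exact hux' h''.symm
          · exact hwx h''.symm) (by rw [h]; exact Sym2.mem_mk_left _ _)
      have h2 : s(u, w) ≠ s(x, z) := fun h => by
        have : x ∈ s(u, w) := by rw [h]; exact Sym2.mem_mk_left _ _
        rcases Sym2.mem_iff.1 this with h'' | h''
        · exact hux' h''.symm
        · exact hwx h''.symm
      have h3 : s(u, w) ≠ s(y, z) := fun h => hg (h ▸ hE)
      rw [mem_swap_other ω' h3 h1] at hsw
      exact hru.trans ((openGraph_adj (ω' ∩ insert s(y, z) (E \ {s(x, y), s(x, z)})) u w).2
        ⟨⟨hsw, mem_contracted.2 (Or.inr ⟨hE, h1, h2⟩)⟩, hne⟩).reachable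
    · -- u = x: w is y or z
      rcases nbr_eq hdeg hE with rfl | rfl
      · rcases hr with h | h
        · exact h
        · exact h.trans (hyz_adj hgred).symm.reachable
      · rcases hr with h | h
        · exact h.trans (hyz_adj hgred).reachable
        · exact h

omit hxs in
/-- **Reachability corresponds, backward**: a vertex joined to `s` in `ω' ∩ E'` is joined to `s` in `swap ω' ∩ E`. -/
theorem reach_backward (ω' : Set (Sym2 V)) (hT : s(y, z) ∈ ω' ↔ s(x, z) ∈ ω') (u : V)
    (hu : (openGraph (ω' ∩ insert s(y, z) (E \ {s(x, y), s(x, z)}))).Reachable s u) :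
    (openGraph (swap s(x, y) s(y, z) ω' ∩ E)).Reachable s u := by
  have hge := g_ne_e (y := y) (z := z) hxy hxz
  have hgf := g_ne_f (y := y) (z := z) hxy hxz
  have hef := e_ne_f (x := x) hyz
  set A := openGraph (swap s(x, y) s(y, z) ω' ∩ E) with hA
  suffices hcl : ∀ u w, A.Reachable s u → (openGraph (ω' ∩ insert s(y, z) (E \ {s(x, y), s(x, z)}))).Adj u w → A.Reachable s w by
    obtain ⟨p⟩ := hu
    exact reach_closed hcl p (SimpleGraph.Reachable.refl _)
  rintro u w hru hadj
  rw [openGraph_adj] at hadj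
  obtain ⟨⟨hω, hE'⟩, hne⟩ := hadj
  rcases mem_contracted.1 hE' with hguw | ⟨hE, h1, h2⟩
  · -- the merged pair: go through x
    have hgred : s(y, z) ∈ ω' := hguw ▸ hω
    have hex : A.Adj y x :=
      (openGraph_adj _ y x).2 ⟨⟨by rw [Sym2.eq_swap (a := y) (b := x)]; exact (mem_swap_e hge ω').2 hgred,
        by rw [Sym2.eq_swap (a := y) (b := x)]; exact he⟩, hxy.symm⟩
    have hfx : A.Adj x z :=
      (openGraph_adj _ x z).2 ⟨⟨(mem_swap_other ω' hgf.symm (Ne.symm hef)).2 (hT.1 hgred), hf⟩, hxz⟩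
    have huw : (u = y ∧ w = z) ∨ (u = z ∧ w = y) := by
      rcases Sym2.eq_iff.1 hguw with ⟨h1, h2⟩ | ⟨h1, h2⟩
      · exact Or.inl ⟨h1, h2⟩
      · exact Or.inr ⟨h1, h2⟩
    rcases huw with ⟨rfl, rfl⟩ | ⟨rfl, rfl⟩
    · exact hru.trans (hex.reachable.trans hfx.reachable)
    · exact hru.trans (hfx.symm.reachable.trans hex.symm.reachable)
  · have h3 : s(u, w) ≠ s(y, z) := fun h => hg (h ▸ hE)
    exact hru.trans ((openGraph_adj (swap s(x, y) s(y, z) ω' ∩ E) u w).2 ⟨⟨(mem_swap_other ω' h3 h1).2 hω, hE⟩, hne⟩).reachable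

/-- **Reachability corresponds** (tied colourings, vertices other than `x`). [this work] -/
theorem reach_swap (ω' : Set (Sym2 V)) (hT : s(y, z) ∈ ω' ↔ s(x, z) ∈ ω') {u : V} (hux : u ≠ x) :
    (openGraph (swap s(x, y) s(y, z) ω' ∩ E)).Reachable s u ↔ (openGraph (ω' ∩ insert s(y, z) (E \ {s(x, y), s(x, z)}))).Reachable s u := by
  constructor
  · intro h
    rcases reach_forward hxs hxy hxz hyz he hf hdeg hg ω' hT u h with ⟨-, h'⟩ | ⟨h', -⟩
    · exact h'
    · exact absurd h' hux
  · exact reach_backward hxy hxz hyz he hf hdeg hg ω' hT u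

/-- **Reachability of `x`** (tied colourings): `x` is joined to `s` in `swap ω' ∩ E` iff `g` is red and `y` or `z` is joined to `s` in `ω' ∩ E'`.
[this work] -/
theorem reach_swap_x (ω' : Set (Sym2 V)) (hT : s(y, z) ∈ ω' ↔ s(x, z) ∈ ω') :
    (openGraph (swap s(x, y) s(y, z) ω' ∩ E)).Reachable s x ↔
      s(y, z) ∈ ω' ∧ ((openGraph (ω' ∩ insert s(y, z) (E \ {s(x, y), s(x, z)}))).Reachable s y ∨
        (openGraph (ω' ∩ insert s(y, z) (E \ {s(x, y), s(x, z)}))).Reachable s z) := by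
  have hge := g_ne_e (y := y) (z := z) hxy hxz
  have hgf := g_ne_f (y := y) (z := z) hxy hxz
  have hef := e_ne_f (x := x) hyz
  constructor
  · intro h
    rcases reach_forward hxs hxy hxz hyz he hf hdeg hg ω' hT x h with ⟨h', -⟩ | ⟨-, h'⟩
    · exact absurd rfl h'
    · exact h'
  · rintro ⟨hgred, hy | hz⟩
    · refine (reach_backward hxy hxz hyz he hf hdeg hg ω' hT y hy).trans (SimpleGraph.Adj.reachable ?_)
      exact (openGraph_adj _ y x).2 ⟨⟨by rw [Sym2.eq_swap (a := y) (b := x)]; exact (mem_swap_e hge ω').2 hgred,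
        by rw [Sym2.eq_swap (a := y) (b := x)]; exact he⟩, hxy.symm⟩
    · refine (reach_backward hxy hxz hyz he hf hdeg hg ω' hT z hz).trans (SimpleGraph.Adj.reachable ?_)
      exact (openGraph_adj _ z x).2
        ⟨⟨by rw [Sym2.eq_swap (a := z) (b := x)]; exact (mem_swap_other ω' hgf.symm (Ne.symm hef)).2 (hT.1 hgred),
          by rw [Sym2.eq_swap (a := z) (b := x)]; exact hf⟩, hxz.symm⟩

/-- **Clusters correspond**: the red edge cluster of `s` in the tied colouring `swap ω'` of `E` is the expansion of that of `ω'` on the contracted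
edge set `E'`. [this work] -/
theorem cluster_swap (ω' : Set (Sym2 V)) (hT : s(y, z) ∈ ω' ↔ s(x, z) ∈ ω') :
    openEdgeCluster (swap s(x, y) s(y, z) ω' ∩ E) s =
      expand s(x, y) s(x, z) s(y, z) (openEdgeCluster (ω' ∩ insert s(y, z) (E \ {s(x, y), s(x, z)})) s) := by
  have hge := g_ne_e (y := y) (z := z) hxy hxz
  have hgf := g_ne_f (y := y) (z := z) hxy hxz
  have hef := e_ne_f (x := x) hyz
  set E' := insert s(y, z) (E \ {s(x, y), s(x, z)}) with hE'
  have hgE' : s(y, z) ∈ E' := Set.mem_insert _ _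
  have heE' : s(x, y) ∉ E' := fun h => by
    rcases mem_contracted.1 h with h | ⟨-, h, -⟩
    · exact hge h.symm
    · exact h rfl
  have hfE' : s(x, z) ∉ E' := fun h => by
    rcases mem_contracted.1 h with h | ⟨-, -, h⟩
    · exact hgf h.symm
    · exact h rfl
  -- membership of g in the small cluster
  have hgC : s(y, z) ∈ openEdgeCluster (ω' ∩ E') s ↔ s(y, z) ∈ ω' ∧ (openGraph (ω' ∩ E')).Reachable s y ∧ (openGraph (ω' ∩ E')).Reachable s z := by
    rw [mem_openEdgeCluster_iff]
    constructor
    · rintro ⟨⟨h1, -⟩, -, h3⟩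
      exact ⟨h1, h3 y (Sym2.mem_mk_left _ _), h3 z (Sym2.mem_mk_right _ _)⟩
    · rintro ⟨h1, h2, h3⟩
      refine ⟨⟨h1, hgE'⟩, by rw [Sym2.mk_isDiag_iff]; exact hyz, fun v hv => ?_⟩
      rcases Sym2.mem_iff.1 hv with rfl | rfl
      · exact h2
      · exact h3
  -- when g is red, one reached endpoint gives both
  have hboth : s(y, z) ∈ ω' → ((openGraph (ω' ∩ E')).Reachable s y ∨ (openGraph (ω' ∩ E')).Reachable s z) →
      (openGraph (ω' ∩ E')).Reachable s y ∧ (openGraph (ω' ∩ E')).Reachable s z := by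
    intro hgred h
    have hadj : (openGraph (ω' ∩ E')).Adj y z := by rw [openGraph_adj]; exact ⟨⟨hgred, hgE'⟩, hyz⟩
    rcases h with h | h
    · exact ⟨h, h.trans hadj.reachable⟩
    · exact ⟨h.trans hadj.symm.reachable, h⟩
  ext h
  rw [mem_openEdgeCluster_iff]
  simp only [expand, Set.mem_setOf_eq]
  by_cases h_e : h = s(x, y)
  · subst h_e
    rw [Set.mem_inter_iff, mem_swap_e hge, hgC]
    constructor
    · rintro ⟨⟨hgred, -⟩, -, hr⟩
      have hx := (reach_swap_x hxs hxy hxz hyz he hf hdeg hg ω' hT).1 (hr x (Sym2.mem_mk_left _ _))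
      exact Or.inr ⟨⟨hgred, hboth hgred hx.2⟩, Or.inl rfl⟩
    · rintro (⟨⟨⟨-, h⟩, -⟩, -⟩ | ⟨⟨hgred, hy, hz⟩, -⟩)
      · exact absurd h heE'
      · refine ⟨⟨hgred, he⟩, by rw [Sym2.mk_isDiag_iff]; exact hxy, fun v hv => ?_⟩
        rcases Sym2.mem_iff.1 hv with rfl | rfl
        · exact (reach_swap_x hxs hxy hxz hyz he hf hdeg hg ω' hT).2 ⟨hgred, Or.inl hy⟩
        · exact (reach_swap hxs hxy hxz hyz he hf hdeg hg ω' hT hxy.symm).2 hy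
  by_cases h_f : h = s(x, z)
  · subst h_f
    rw [Set.mem_inter_iff, mem_swap_other ω' hgf.symm (Ne.symm hef), ← hT, hgC]
    constructor
    · rintro ⟨⟨hgred, -⟩, -, hr⟩
      have hx := (reach_swap_x hxs hxy hxz hyz he hf hdeg hg ω' hT).1 (hr x (Sym2.mem_mk_left _ _))
      exact Or.inr ⟨⟨hgred, hboth hgred hx.2⟩, Or.inr rfl⟩
    · rintro (⟨⟨⟨-, h⟩, -⟩, -⟩ | ⟨⟨hgred, hy, hz⟩, -⟩)
      · exact absurd h hfE'
      · refine ⟨⟨hgred, hf⟩, by rw [Sym2.mk_isDiag_iff]; exact hxz, fun v hv => ?_⟩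
        rcases Sym2.mem_iff.1 hv with rfl | rfl
        · exact (reach_swap_x hxs hxy hxz hyz he hf hdeg hg ω' hT).2 ⟨hgred, Or.inr hz⟩
        · exact (reach_swap hxs hxy hxz hyz he hf hdeg hg ω' hT hxz.symm).2 hz
  by_cases h_g : h = s(y, z)
  · subst h_g
    constructor
    · rintro ⟨⟨-, hE⟩, -, -⟩
      exact absurd hE hg
    · rintro (⟨-, h⟩ | ⟨-, h | h⟩)
      · exact absurd rfl h
      · exact absurd h hge
      · exact absurd h hgf
  -- a pair other than e, f, g: same colour, same endpoints (none of them x)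
  rw [Set.mem_inter_iff, mem_swap_other ω' h_g h_e, mem_openEdgeCluster_iff, Set.mem_inter_iff, mem_contracted]
  constructor
  · rintro ⟨⟨hω, hE⟩, hd, hr⟩
    refine Or.inl ⟨⟨⟨hω, Or.inr ⟨hE, h_e, h_f⟩⟩, hd, fun v hv => ?_⟩, h_g⟩
    have hvx : v ≠ x := fun hvx => x_notMem hdeg hE h_e h_f (hvx ▸ hv)
    exact (reach_swap hxs hxy hxz hyz he hf hdeg hg ω' hT hvx).1 (hr v hv)
  · rintro (⟨⟨⟨hω, hE'⟩, hd, hr⟩, -⟩ | ⟨-, h1 | h1⟩)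
    · rcases hE' with h1 | ⟨hE, -, -⟩
      · exact absurd h1 h_g
      · refine ⟨⟨hω, hE⟩, hd, fun v hv => ?_⟩
        have hvx : v ≠ x := fun hvx => x_notMem hdeg hE h_e h_f (hvx ▸ hv)
        exact (reach_swap hxs hxy hxz hyz he hf hdeg hg ω' hT hvx).2 (hr v hv)
    · exact absurd h1 h_e
    · exact absurd h1 h_f

end Graph

end Contract

end Antithetic

end Summit.CriticalPhenomena.PercolationContinuityZ3.Theorems
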